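import Literature.NumberTheory.Automorphic.ArchCentralOrbitalFamilyParamOpen   -- ★ p851275 (this seat) (c-ii): the central reader `Φ_c` (beta-reduced), `T₂`; brings ★ p851244 (`exists_closedBall_isCompact_conj_…`), ★ `isCompact_setOf_coe_archLocal_mem`, ★ `angleChart_ne_of_mem_chamber_ball`
import Literature.NumberTheory.Automorphic.ArchLocalRegularOrbitClosed        -- ★ `locallyCompactSpace_archLocal`, `secondCountableTopology_archLocal`
import Literature.MeasureTheory.Constructions.PiOptionIntegral                -- ★ (LH10-p02): `integral_pi_of_isEmpty`
import HarnessLib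

/-!
# The `m`-fold CENTRAL orbital tower on `Π_k G_{w_k}` (scalar compact places): empty base, vanishing, and the FUBINI PEEL `H e (m+1) = Φ_{e 0} ∘ H (e ∘ succ) m`
# (Fubini over a DEPENDENT `Measure.pi`; Rogawski 1990 §8.2, §3.6; Varadarajan 1977 I §1.12)

Topic `NumberTheory/Automorphic`; namespace `Literature.NumberTheory.Automorphic.UnitaryGroup`.  THEOREMS ONLY (no `def`, no instance, no notation, no axiom, no named fact, no `sorry`);
kernel lane `--kind proof --supports stmt-HodgeConjecture-24833`.  Cell `pub/hodgecm-mathlib`, crux H413 (`stmt-HodgeConjecture-24833`), F0∕P3c line LH3 (leaf `F0_P3c_StubN9Direct` v5.1),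
organ **O-L1d′ `stub_N9hcCentralMixedJetBounds`** (LH3-plan (g4) RULING #19: (hCm-ASM) → F0P3a-p08 (g23)); brick «`H₂` = the central Fubini tower» (the stage-2 tower of ★ (E5)
`contDiffOn_and_forall_bound_twoStage_nestedBlockReaders`, sockets `hH0`∕`hHsucc`∕`hHzero` of ★ (E4) `contDiffOn_and_forall_bound_nestedBlockReaders`).  Twin of ★ (J) p851247
`ArchCayleyTowerFubini` (LH7-p02 (g4)) with TWO changes: the carrier of slot `k` is the LOCAL GROUP `G_{e k} = archLocal L 3 (diagonal α) (e k)` of the `k`-th scalar place (`e : ℕ → places`,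
so the product `Π_{k<m} G_{e k}` and `⊗_k ν_{e k}` are DEPENDENT), and the block reader is the rank-two CENTRAL reader of ★ p851275,
  `Φ_w F θ = (rootProduct θ : ℝ) • ∫_{G_w} F(↑↑(g · diag(ζ_w e^{iθ_i}) · g⁻¹)) dν_w`.
THE TOWER (closed form, beta-reduced in every statement):
  `H e m P′ f (q, θ) = (∏_k rootProduct (θ k)) • ∫_{Π_k G_{e k}} f (q, (↑↑(g_k · diag(ζ_{e k} e^{iθ_k}) · g_k⁻¹))_k) d(⊗_k ν_{e k})`.
* §1 **`isCompact_setOf_conj_centralTorus_mem`** — at a chamber angle `θ ∈ T₂` (regular) the set of `g ∈ G_w` conjugating `diag(ζ e^{iθ})` into a compact set of matrices is compact (★ p851244 §1);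
* §2 **`integrable_centralTowerIntegrand`** — at chamber angles the `m`-fold integrand is continuous with support in the compact box `Π_k S_k`, hence integrable for `⊗_k ν_{e k}`;
* §3 THE SOCKETS **`centralTower_zero`** (`hH0`, ★ `integral_pi_of_isEmpty`), **`centralTower_eq_zero`** (`hHzero`), **`centralTower_succ`** (`hHsucc`: peel slot `0` — `Fin.prod_univ_succ`, Mathlib
  `measurePreserving_piFinSuccAbove (fun k => ν (e k)) 0` on the dependent product (`Fin.succAbove 0 j = j.succ` definitionally), `integral_prod`, `Fin.cons`∕`Fin.tail`).
HONEST LABEL: measure-theoretic bookkeeping, count-neutral; HC_CM is proved only modulo the 7 printed citations (2 remaining: hLiu418 = stmt-HodgeConjecture-24832, h413 =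
stmt-HodgeConjecture-24833) until rung 0 closes.

## References
* [Rogawski1990] J. D. Rogawski, *Automorphic Representations of Unitary Groups in Three Variables*, Ann. of Math. Stud. 123 (1990), §8.2 pp. 119–123, §3.6 p. 31.
* [Varadarajan1977] V. S. Varadarajan, *Harmonic Analysis on Real Reductive Groups*, LNM 576 (1977), Part I §1.12.
* [vanDoorn2021HaarMeasure] F. van Doorn, *Formalized Haar Measure*, ITP 2021, LIPIcs 193 (2021), §4 Thm. 3, §7.
* [DeitmarEchterhoff2014] A. Deitmar, S. Echterhoff, *Principles of Harmonic Analysis*, 2nd ed. (2014), Lemma 9.3.3.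
-/

set_option autoImplicit false

noncomputable section

namespace Literature.NumberTheory.Automorphic

namespace UnitaryGroup

open _root_.MeasureTheory _root_.MeasureTheory.Measure _root_.Set _root_.Filter _root_.Topology _root_.NumberField _root_.NumberField.InfinitePlace _root_.Metric
open _root_.Literature.MeasureTheory.Constructions _root_.Literature.Geometry.ComplexHyperbolic.BallModel _root_.Literature.NumberTheory.Rogawski1990
open scoped MatrixGroups ContDiff Matrix.Norms.Operator

variable (L : Type) [Field L] (α : Fin 3 → L)
  [∀ w : {w : InfinitePlace L // IsComplex w}, MeasurableSpace (archLocal L 3 (Matrix.diagonal α) w)] [∀ w : {w : InfinitePlace L // IsComplex w}, BorelSpace (archLocal L 3 (Matrix.diagonal α) w)]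
  (ν : ∀ w : {w : InfinitePlace L // IsComplex w}, Measure (archLocal L 3 (Matrix.diagonal α) w)) (ζ : {w : InfinitePlace L // IsComplex w} → Circle)

/-! ## §1 Compact conjugating set at a chamber angle -/

omit [∀ w : {w : InfinitePlace L // IsComplex w}, MeasurableSpace (archLocal L 3 (Matrix.diagonal α) w)] [∀ w : {w : InfinitePlace L // IsComplex w}, BorelSpace (archLocal L 3 (Matrix.diagonal α) w)] in
/-- **At a chamber angle the conjugating set is compact**: for `θ ∈ T₂` (so `ζ e^{iθ_i}` pairwise distinct, ★ `angleChart_ne_of_mem_chamber_ball`) and a compact `C ⊆ M₃(ℂ)`,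
`{g ∈ G_w | ↑↑(g · diag(ζ_w e^{iθ}) · g⁻¹) ∈ C}` is compact (★ p851244 §1 with singleton blocks at the regular angle; ★ `isCompact_setOf_coe_archLocal_mem`).
[cite: Rogawski1990, §8.2 p. 122] [cite: DeitmarEchterhoff2014, Lemma 9.3.3] -/
theorem isCompact_setOf_conj_centralTorus_mem (hα : ∀ i, α i ≠ 0) (w : {w : InfinitePlace L // IsComplex w}) (hreal : ∀ i, (w.1.embedding (α i)).im = 0)
    {θ : Fin 3 → ℝ} (hθ : θ ∈ ({θ : Fin 3 → ℝ | ∃ σ : Equiv.Perm (Fin 3), θ (σ 0) < θ (σ 1) ∧ θ (σ 1) < θ (σ 2)} ∩ ball (0 : Fin 3 → ℝ) (1 / 2))) {C : Set (Matrix (Fin 3) (Fin 3) ℂ)} (hC : IsCompact C) :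
    IsCompact {g : archLocal L 3 (Matrix.diagonal α) w | (((g * (⟨circleDiagonal 3 (fun i => ζ w * Circle.exp (θ i)), circleDiagonal_mem_archLocal_diagonal L 3 α w _⟩ : archLocal L 3 (Matrix.diagonal α) w) * (g)⁻¹ : archLocal L 3 (Matrix.diagonal α) w) : GL (Fin 3) ℂ) : Matrix (Fin 3) (Fin 3) ℂ) ∈ C} := by
  obtain ⟨⟨σ, hσ⟩, hball⟩ := hθ
  have hreg : ∀ i j : Fin 3, i ≠ j → ζ w * Circle.exp (θ i) ≠ ζ w * Circle.exp (θ j) := fun i j hij => angleChart_ne_of_mem_chamber_ball (ζ w) σ ⟨hσ, hball⟩ i j hij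
  have hCg : IsCompact {k : archLocal L 3 (Matrix.diagonal α) w | ((k : GL (Fin 3) ℂ) : Matrix (Fin 3) (Fin 3) ℂ) ∈ C} := isCompact_setOf_coe_archLocal_mem L 3 α w hα hC
  obtain ⟨δ, hδ, S, hS, hS0⟩ := exists_closedBall_isCompact_conj_circleDiagonal_angles_not_mem_of_blocks L 3 α w hα hreal (b := fun i : Fin 3 => i)
    (fun i j hij hb => absurd hb hij) hCg (fun _ => ζ w) θ (fun i j hij => hreg i j hij)
  have hcont : Continuous fun g : archLocal L 3 (Matrix.diagonal α) w => (((g * (⟨circleDiagonal 3 (fun i => ζ w * Circle.exp (θ i)), circleDiagonal_mem_archLocal_diagonal L 3 α w _⟩ : archLocal L 3 (Matrix.diagonal α) w) * (g)⁻¹ : archLocal L 3 (Matrix.diagonal α) w) : GL (Fin 3) ℂ) : Matrix (Fin 3) (Fin 3) ℂ) :=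
    (Units.continuous_val.comp continuous_subtype_val).comp ((continuous_id.mul continuous_const).mul continuous_id.inv)
  refine hS.of_isClosed_subset (hC.isClosed.preimage hcont) fun g hg => ?_
  by_contra hgS
  exact hS0 g hgS θ (Metric.mem_closedBall_self hδ.le) hg

/-! ## §2 Integrability of the `m`-fold central tower integrand at chamber angles -/

variable {E : Type} [NormedAddCommGroup E] [NormedSpace ℝ E]

omit [NormedSpace ℝ E] in
/-- **The `m`-fold central integrand is continuous with compact support, hence integrable** at chamber angles: for `F : (Fin m → M₃(ℂ)) → E` continuous and vanishing as soon as one block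
variable leaves the compact `C`, `g ↦ F ((↑↑(g_k · diag · g_k⁻¹))_k)` vanishes off the compact box `Π_k S_k` (§1), so it is integrable for the Haar measure `⊗_k ν_{e k}` on `Π_k G_{e k}`.
[cite: Rogawski1990, §8.2 p. 122] [cite: vanDoorn2021HaarMeasure, §7] -/
theorem integrable_centralTowerIntegrand (hα : ∀ i, α i ≠ 0) (hreal : ∀ (w : {w : InfinitePlace L // IsComplex w}) (i : Fin 3), (w.1.embedding (α i)).im = 0)
    [∀ w : {w : InfinitePlace L // IsComplex w}, (ν w).IsHaarMeasure] (e : ℕ → {w : InfinitePlace L // IsComplex w}) {m : ℕ}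
    (F : (Fin m → Matrix (Fin 3) (Fin 3) ℂ) → E) (hF : Continuous F)
    {C : Set (Matrix (Fin 3) (Fin 3) ℂ)} (hC : IsCompact C) (hFC : ∀ X : Fin m → Matrix (Fin 3) (Fin 3) ℂ, (∃ k, X k ∉ C) → F X = 0)
    (θ : Fin m → Fin 3 → ℝ) (hθ : ∀ k, θ k ∈ ({θ : Fin 3 → ℝ | ∃ σ : Equiv.Perm (Fin 3), θ (σ 0) < θ (σ 1) ∧ θ (σ 1) < θ (σ 2)} ∩ ball (0 : Fin 3 → ℝ) (1 / 2))) :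
    Integrable (fun g : ((k : Fin m) → archLocal L 3 (Matrix.diagonal α) (e k.val)) => F (fun k => (((g k * (⟨circleDiagonal 3 (fun i => ζ (e k.val) * Circle.exp ((θ k) i)), circleDiagonal_mem_archLocal_diagonal L 3 α (e k.val) _⟩ : archLocal L 3 (Matrix.diagonal α) (e k.val)) * (g k)⁻¹ : archLocal L 3 (Matrix.diagonal α) (e k.val)) : GL (Fin 3) ℂ) : Matrix (Fin 3) (Fin 3) ℂ)))
      (Measure.pi fun k : Fin m => ν (e k.val)) := by
  haveI : ∀ w : {w : InfinitePlace L // IsComplex w}, LocallyCompactSpace (archLocal L 3 (Matrix.diagonal α) w) := fun w => locallyCompactSpace_archLocal L 3 (Matrix.diagonal α) w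
  haveI : ∀ w : {w : InfinitePlace L // IsComplex w}, SecondCountableTopology (archLocal L 3 (Matrix.diagonal α) w) := fun w => secondCountableTopology_archLocal L 3 (Matrix.diagonal α) w
  -- continuity of the block map
  have hA : Continuous fun g : ((k : Fin m) → archLocal L 3 (Matrix.diagonal α) (e k.val)) => fun k => (((g k * (⟨circleDiagonal 3 (fun i => ζ (e k.val) * Circle.exp ((θ k) i)), circleDiagonal_mem_archLocal_diagonal L 3 α (e k.val) _⟩ : archLocal L 3 (Matrix.diagonal α) (e k.val)) * (g k)⁻¹ : archLocal L 3 (Matrix.diagonal α) (e k.val)) : GL (Fin 3) ℂ) : Matrix (Fin 3) (Fin 3) ℂ) :=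
    continuous_pi fun k => (Units.continuous_val.comp continuous_subtype_val).comp
      ((((continuous_apply k).mul continuous_const)).mul (continuous_apply k).inv)
  refine (hF.comp hA).integrable_of_hasCompactSupport ?_
  have hS : ∀ k : Fin m, IsCompact {g : archLocal L 3 (Matrix.diagonal α) (e k.val) | (((g * (⟨circleDiagonal 3 (fun i => ζ (e k.val) * Circle.exp ((θ k) i)), circleDiagonal_mem_archLocal_diagonal L 3 α (e k.val) _⟩ : archLocal L 3 (Matrix.diagonal α) (e k.val)) * (g)⁻¹ : archLocal L 3 (Matrix.diagonal α) (e k.val)) : GL (Fin 3) ℂ) : Matrix (Fin 3) (Fin 3) ℂ) ∈ C} :=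
    fun k => isCompact_setOf_conj_centralTorus_mem L α ζ hα (e k.val) (hreal (e k.val)) (hθ k) hC
  refine HasCompactSupport.intro (isCompact_univ_pi hS) fun g hg => ?_
  simp only [mem_univ_pi, mem_setOf_eq, not_forall] at hg
  obtain ⟨k, hk⟩ := hg
  exact hFC _ ⟨k, hk⟩

/-! ## §3 The three sockets of the ★ (E4) tower: empty base, vanishing, Fubini peel -/

variable [CompleteSpace E]

omit [∀ w : {w : InfinitePlace L // IsComplex w}, BorelSpace (archLocal L 3 (Matrix.diagonal α) w)] in
/-- **`hH0` — EMPTY BASE**: over `Fin 0` the product of `rootProduct`s is `1` and `Measure.pi` is the Dirac mass at the empty tuple (★ `integral_pi_of_isEmpty`), so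
`H e 0 P′ f (q, θ) = f (q, Fin.elim0)`. [cite: vanDoorn2021HaarMeasure, §7] -/
theorem centralTower_zero (e : ℕ → {w : InfinitePlace L // IsComplex w}) (P' : Type) (f : P' × (Fin 0 → Matrix (Fin 3) (Fin 3) ℂ) → E) (q : P') (θ : Fin 0 → Fin 3 → ℝ) :
    (∏ k : Fin 0, rootProduct (θ k)) • ∫ g : ((k : Fin 0) → archLocal L 3 (Matrix.diagonal α) (e k.val)),
        f (q, fun k => (((g k * (⟨circleDiagonal 3 (fun i => ζ (e k.val) * Circle.exp ((θ k) i)), circleDiagonal_mem_archLocal_diagonal L 3 α (e k.val) _⟩ : archLocal L 3 (Matrix.diagonal α) (e k.val)) * (g k)⁻¹ : archLocal L 3 (Matrix.diagonal α) (e k.val)) : GL (Fin 3) ℂ) : Matrix (Fin 3) (Fin 3) ℂ)) ∂(Measure.pi fun k : Fin 0 => ν (e k.val)) =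
      f (q, fun k => k.elim0) := by
  rw [Finset.univ_eq_empty, Finset.prod_empty, one_smul, integral_pi_of_isEmpty]
  congr 1
  exact congrArg _ (funext fun k => k.elim0)

omit [∀ w : {w : InfinitePlace L // IsComplex w}, BorelSpace (archLocal L 3 (Matrix.diagonal α) w)] [CompleteSpace E] in
/-- **`hHzero` — VANISHING**: if `f (q, ·) ≡ 0` then `H e m P′ f (q, θ) = 0`. [cite: vanDoorn2021HaarMeasure, §4 Thm. 3] -/
theorem centralTower_eq_zero (e : ℕ → {w : InfinitePlace L // IsComplex w}) (m : ℕ) (P' : Type) (f : P' × (Fin m → Matrix (Fin 3) (Fin 3) ℂ) → E) (q : P') (θ : Fin m → Fin 3 → ℝ) (h0 : ∀ X, f (q, X) = 0) :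
    (∏ k : Fin m, rootProduct (θ k)) • ∫ g : ((k : Fin m) → archLocal L 3 (Matrix.diagonal α) (e k.val)),
        f (q, fun k => (((g k * (⟨circleDiagonal 3 (fun i => ζ (e k.val) * Circle.exp ((θ k) i)), circleDiagonal_mem_archLocal_diagonal L 3 α (e k.val) _⟩ : archLocal L 3 (Matrix.diagonal α) (e k.val)) * (g k)⁻¹ : archLocal L 3 (Matrix.diagonal α) (e k.val)) : GL (Fin 3) ℂ) : Matrix (Fin 3) (Fin 3) ℂ)) ∂(Measure.pi fun k : Fin m => ν (e k.val)) = 0 := by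
  simp only [h0, integral_zero, smul_zero]

omit [CompleteSpace E] in
/-- **`hHsucc` — THE FUBINI PEEL on the dependent product**: for `f` smooth on `Q ×ˢ univ` (`Q` open), vanishing as soon as one block variable leaves a compact `C`, `q ∈ Q` and CHAMBER angles
`θ`, the `(m+1)`-fold central tower is the central reader at the place `e 0` of the slot-`0` block applied to the `m`-fold tower over the places `e ∘ succ` of the re-indexed family
`f̃ ((q, X₀), X′) = f (q, Fin.cons X₀ X′)` at `((q, X₀), Fin.tail θ)`. [cite: Rogawski1990, §8.2 p. 122; §3.6 p. 31] [cite: vanDoorn2021HaarMeasure, §4 Thm. 3] [cite: Varadarajan1977, I §1.12] -/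
theorem centralTower_succ (hα : ∀ i, α i ≠ 0) (hreal : ∀ (w : {w : InfinitePlace L // IsComplex w}) (i : Fin 3), (w.1.embedding (α i)).im = 0)
    [∀ w : {w : InfinitePlace L // IsComplex w}, (ν w).IsHaarMeasure] (e : ℕ → {w : InfinitePlace L // IsComplex w})
    (m : ℕ) (P' : Type) [NormedAddCommGroup P'] [NormedSpace ℝ P'] (Q : Set P') (_hQ : IsOpen Q)
    (f : P' × (Fin (m + 1) → Matrix (Fin 3) (Fin 3) ℂ) → E) (hf : ContDiffOn ℝ ∞ f (Q ×ˢ univ))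
    (hC : ∃ C : Set (Matrix (Fin 3) (Fin 3) ℂ), IsCompact C ∧ ∀ (q : P') (X : Fin (m + 1) → Matrix (Fin 3) (Fin 3) ℂ), (∃ k, X k ∉ C) → f (q, X) = 0)
    (q : P') (hq : q ∈ Q) (θ : Fin (m + 1) → Fin 3 → ℝ) (hθ : ∀ k, θ k ∈ ({θ : Fin 3 → ℝ | ∃ σ : Equiv.Perm (Fin 3), θ (σ 0) < θ (σ 1) ∧ θ (σ 1) < θ (σ 2)} ∩ ball (0 : Fin 3 → ℝ) (1 / 2))) :
    (∏ k : Fin (m + 1), rootProduct (θ k)) • ∫ g : ((k : Fin (m + 1)) → archLocal L 3 (Matrix.diagonal α) (e k.val)),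
        f (q, fun k => (((g k * (⟨circleDiagonal 3 (fun i => ζ (e k.val) * Circle.exp ((θ k) i)), circleDiagonal_mem_archLocal_diagonal L 3 α (e k.val) _⟩ : archLocal L 3 (Matrix.diagonal α) (e k.val)) * (g k)⁻¹ : archLocal L 3 (Matrix.diagonal α) (e k.val)) : GL (Fin 3) ℂ) : Matrix (Fin 3) (Fin 3) ℂ)) ∂(Measure.pi fun k : Fin (m + 1) => ν (e k.val)) =
      (rootProduct (θ 0) : ℝ) • ∫ g₀ : archLocal L 3 (Matrix.diagonal α) (e 0), (fun X₀ : Matrix (Fin 3) (Fin 3) ℂ =>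
        (∏ k : Fin m, rootProduct ((Fin.tail θ) k)) • ∫ h : ((k : Fin m) → archLocal L 3 (Matrix.diagonal α) ((fun k => e (k + 1)) k.val)),
        (fun p : (P' × Matrix (Fin 3) (Fin 3) ℂ) × (Fin m → Matrix (Fin 3) (Fin 3) ℂ) => f (p.1.1, Fin.cons p.1.2 p.2)) ((q, X₀), fun k => (((h k * (⟨circleDiagonal 3 (fun i => ζ ((fun k => e (k + 1)) k.val) * Circle.exp (((Fin.tail θ) k) i)), circleDiagonal_mem_archLocal_diagonal L 3 α ((fun k => e (k + 1)) k.val) _⟩ : archLocal L 3 (Matrix.diagonal α) ((fun k => e (k + 1)) k.val)) * (h k)⁻¹ : archLocal L 3 (Matrix.diagonal α) ((fun k => e (k + 1)) k.val)) : GL (Fin 3) ℂ) : Matrix (Fin 3) (Fin 3) ℂ)) ∂(Measure.pi fun k : Fin m => ν ((fun k => e (k + 1)) k.val)))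
        (((g₀ * (⟨circleDiagonal 3 (fun i => ζ (e 0) * Circle.exp ((θ 0) i)), circleDiagonal_mem_archLocal_diagonal L 3 α (e 0) _⟩ : archLocal L 3 (Matrix.diagonal α) (e 0)) * (g₀)⁻¹ : archLocal L 3 (Matrix.diagonal α) (e 0)) : GL (Fin 3) ℂ) : Matrix (Fin 3) (Fin 3) ℂ) ∂(ν (e 0)) := by
  haveI : ∀ w : {w : InfinitePlace L // IsComplex w}, LocallyCompactSpace (archLocal L 3 (Matrix.diagonal α) w) := fun w => locallyCompactSpace_archLocal L 3 (Matrix.diagonal α) w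
  haveI : ∀ w : {w : InfinitePlace L // IsComplex w}, SecondCountableTopology (archLocal L 3 (Matrix.diagonal α) w) := fun w => secondCountableTopology_archLocal L 3 (Matrix.diagonal α) w
  obtain ⟨C, hCc, hfC⟩ := hC
  -- the conjugation map at a place and an angle
  have hfq : Continuous fun X : Fin (m + 1) → Matrix (Fin 3) (Fin 3) ℂ => f (q, X) :=
    hf.continuousOn.comp_continuous (continuous_const.prodMk continuous_id) fun X => ⟨hq, mem_univ _⟩
  have hInt : Integrable (fun g : ((k : Fin (m + 1)) → archLocal L 3 (Matrix.diagonal α) (e k.val)) => f (q, fun k => (((g k * (⟨circleDiagonal 3 (fun i => ζ (e k.val) * Circle.exp ((θ k) i)), circleDiagonal_mem_archLocal_diagonal L 3 α (e k.val) _⟩ : archLocal L 3 (Matrix.diagonal α) (e k.val)) * (g k)⁻¹ : archLocal L 3 (Matrix.diagonal α) (e k.val)) : GL (Fin 3) ℂ) : Matrix (Fin 3) (Fin 3) ℂ)))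
      (Measure.pi fun k : Fin (m + 1) => ν (e k.val)) :=
    integrable_centralTowerIntegrand L α ν ζ hα hreal e (fun X => f (q, X)) hfq hCc (fun X hX => hfC q X hX) θ hθ
  -- the peel `(Π_{k ≤ m} G_{e k}) ≃ᵐ G_{e 0} × Π_{j < m} G_{e (j+1)}` is measure preserving
  have hmp := (measurePreserving_piFinSuccAbove (fun k : Fin (m + 1) => ν (e k.val)) 0).symm _
  have hsymm : ∀ p : archLocal L 3 (Matrix.diagonal α) (e ((0 : Fin (m + 1)).val)) × ((j : Fin m) → archLocal L 3 (Matrix.diagonal α) (e (Fin.succAbove (0 : Fin (m + 1)) j).val)),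
      (MeasurableEquiv.piFinSuccAbove (fun k : Fin (m + 1) => archLocal L 3 (Matrix.diagonal α) (e k.val)) 0).symm p =
        (Fin.cons p.1 p.2 : (k : Fin (m + 1)) → archLocal L 3 (Matrix.diagonal α) (e k.val)) := fun p => by
    show Fin.insertNth 0 p.1 p.2 = (Fin.cons p.1 p.2 : (k : Fin (m + 1)) → archLocal L 3 (Matrix.diagonal α) (e k.val))
    exact Fin.insertNth_zero (α := fun k : Fin (m + 1) => archLocal L 3 (Matrix.diagonal α) (e k.val)) p.1 p.2
  have hcv := hmp.integral_comp' (fun g : ((k : Fin (m + 1)) → archLocal L 3 (Matrix.diagonal α) (e k.val)) => f (q, fun k => (((g k * (⟨circleDiagonal 3 (fun i => ζ (e k.val) * Circle.exp ((θ k) i)), circleDiagonal_mem_archLocal_diagonal L 3 α (e k.val) _⟩ : archLocal L 3 (Matrix.diagonal α) (e k.val)) * (g k)⁻¹ : archLocal L 3 (Matrix.diagonal α) (e k.val)) : GL (Fin 3) ℂ) : Matrix (Fin 3) (Fin 3) ℂ)))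
  have hInt' : Integrable (fun p : archLocal L 3 (Matrix.diagonal α) (e ((0 : Fin (m + 1)).val)) × ((j : Fin m) → archLocal L 3 (Matrix.diagonal α) (e (Fin.succAbove (0 : Fin (m + 1)) j).val)) =>
      f (q, fun k => ((((Fin.cons p.1 p.2 : (k : Fin (m + 1)) → archLocal L 3 (Matrix.diagonal α) (e k.val)) k * (⟨circleDiagonal 3 (fun i => ζ (e k.val) * Circle.exp ((θ k) i)), circleDiagonal_mem_archLocal_diagonal L 3 α (e k.val) _⟩ : archLocal L 3 (Matrix.diagonal α) (e k.val)) * ((Fin.cons p.1 p.2 : (k : Fin (m + 1)) → archLocal L 3 (Matrix.diagonal α) (e k.val)) k)⁻¹ : archLocal L 3 (Matrix.diagonal α) (e k.val)) : GL (Fin 3) ℂ) : Matrix (Fin 3) (Fin 3) ℂ)))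
      ((ν (e ((0 : Fin (m + 1)).val))).prod (Measure.pi fun j : Fin m => ν (e (Fin.succAbove (0 : Fin (m + 1)) j).val))) := by
    have h := (hmp.integrable_comp_emb (MeasurableEquiv.measurableEmbedding _)).2 hInt
    refine h.congr (Filter.Eventually.of_forall fun p => ?_)
    simp only [Function.comp_apply, hsymm]
  -- slot bookkeeping
  have hcons : ∀ (g₀ : archLocal L 3 (Matrix.diagonal α) (e ((0 : Fin (m + 1)).val))) (h : (j : Fin m) → archLocal L 3 (Matrix.diagonal α) (e (Fin.succAbove (0 : Fin (m + 1)) j).val)),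
      (fun k => ((((Fin.cons g₀ h : (k : Fin (m + 1)) → archLocal L 3 (Matrix.diagonal α) (e k.val)) k * (⟨circleDiagonal 3 (fun i => ζ (e k.val) * Circle.exp ((θ k) i)), circleDiagonal_mem_archLocal_diagonal L 3 α (e k.val) _⟩ : archLocal L 3 (Matrix.diagonal α) (e k.val)) * ((Fin.cons g₀ h : (k : Fin (m + 1)) → archLocal L 3 (Matrix.diagonal α) (e k.val)) k)⁻¹ : archLocal L 3 (Matrix.diagonal α) (e k.val)) : GL (Fin 3) ℂ) : Matrix (Fin 3) (Fin 3) ℂ)) =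
        Fin.cons (((g₀ * (⟨circleDiagonal 3 (fun i => ζ (e ((0 : Fin (m + 1)).val)) * Circle.exp ((θ 0) i)), circleDiagonal_mem_archLocal_diagonal L 3 α (e ((0 : Fin (m + 1)).val)) _⟩ : archLocal L 3 (Matrix.diagonal α) (e ((0 : Fin (m + 1)).val))) * (g₀)⁻¹ : archLocal L 3 (Matrix.diagonal α) (e ((0 : Fin (m + 1)).val))) : GL (Fin 3) ℂ) : Matrix (Fin 3) (Fin 3) ℂ) (fun j => (((h j * (⟨circleDiagonal 3 (fun i => ζ (e (Fin.succAbove (0 : Fin (m + 1)) j).val) * Circle.exp ((Fin.tail θ j) i)), circleDiagonal_mem_archLocal_diagonal L 3 α (e (Fin.succAbove (0 : Fin (m + 1)) j).val) _⟩ : archLocal L 3 (Matrix.diagonal α) (e (Fin.succAbove (0 : Fin (m + 1)) j).val)) * (h j)⁻¹ : archLocal L 3 (Matrix.diagonal α) (e (Fin.succAbove (0 : Fin (m + 1)) j).val)) : GL (Fin 3) ℂ) : Matrix (Fin 3) (Fin 3) ℂ)) := by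
    intro g₀ h
    funext k
    refine Fin.cases ?_ (fun j => ?_) k
    · simp only [Fin.cons_zero]
    · simp only [Fin.cons_succ, Fin.tail]
      rfl
  rw [← hcv, Fin.prod_univ_succ]
  simp_rw [hsymm]
  rw [integral_prod _ hInt']
  simp_rw [hcons]
  conv_rhs => rw [integral_smul]
  rw [smul_smul]
  rfl

end UnitaryGroup

end Literature.NumberTheory.Automorphic

end
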